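import Literature.MathematicalPhysics.QuantumFieldTheory.Balaban1983to89.B8Prop6CubeMemberNormsGamma
import Literature.MathematicalPhysics.QuantumFieldTheory.Balaban1983to89.B8Prop6DentedCubeMemberGamma

/-!
# `Balaban1983to89.B8Prop6DentedCubeMemberNormsGamma` — [Balaban1985RegularSpaces] PROPOSITION 3 (p. 87) ∕ PROPOSITION 6 (1.136) ∕ [Balaban1985Variational] (152) AT THE DENTED
# CUBE MEMBER, BACKGROUND `1`, FROM THE FOUR-LINE COLLAR SOCKET OVER PRINT's SPLIT CLASS `c.lamBPT` — EDITION γ, dented twin of `B8Prop6CubeMemberNormsGamma`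
# ((d3) MAP item (6): the «Aγ» norms engine of the dented cube road)

statement-level skeleton of published theorems with citation tags; proofs where landed; nothing here is a claim about the
Yang–Mills mass gap

`[Balaban1985RegularSpaces]` ("B8" = [6], CMP **99** (1985) 75–102) Prop. 3 p. 87, Prop. 6 (1.135)–(1.136) p. 99, (1.29) p. 81, (1.31) p. 82, (1.37) p. 82, (1.42) p. 83, (1.55)–(1.62)
pp. 86–87, (1.133) p. 99, p. 77; `[Balaban1985Variational]` ("[15]", CMP **102** (1985) 277–309) (148)–(152) p. 301 («Lʲη|A|, (Lʲη)²|∇A|, (Lʲη)³|∂*∂A|, (Lʲη)³|ΔA| < 9dL²B₁Mε₀ on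
Ω′_j»); [4] = `[Balaban1985BackgroundPropagators]` (3.16) p. 393; [B6] = `[Balaban1984PropagatorsII]` (2.3) p. 224.  PDF held: `paper:balaban1985-cmp99-regular-spaces-gauge-fixing`,
`paper:balaban1985-cmp102-variational-background`.

CITATION HEADER (lean-in-tree rule).  Cell `pub-ymgap` (HUMAN RULING D-0062, Track A), DAG node N05 = [B8], seat `pub-ymgap-dag-n05-e` (g31; row s3b, the (β) road; dag-n05-c standing GO
on dented twins I.42366).  WHY THIS FILE.  The pure chain's norms engine `B8Prop6CubeMemberNormsGamma` (this seat g10) produces the (1.136)₂–₄ members at a cube from the four-line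
(1.59) socket over the split print class and the (1.62)-data of the gauge `u`: §1 (1.42)₂ at all levels by the generic `H42_of_inAx_γ`, §2 Proposition 3's a-priori bound by the
generic `eq155_norm_kLevel_hermitian` ∕ `apriori_160_bdry` ∕ `apriori_162_bdry` ∕ `norm_B1_lt_kLevel_γ` — the ONLY member-specific inputs being the p. 99 datum translation, the
class laws and the level-`0` layer where (1.29) pins `u = 1`.  THIS FILE runs the same composition at the DENTED member `{Ω′_j}` (NODE 00's `CubeB8D`, p655171): datum by
`thm4_hypotheses_one_cutFixed_dented_γ` (p662540), class laws `lamBPT_hbox_pred ∕ lamBPT_hclass` (p662157), and the layer fact through `Λ₀ ⊆ Λ′₀` (`cubeLam_subset_lamS`);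
the canonical exponent is `mlogCfg c.k η c.sq` = `CubeB8D.expo` of `GaugedBoundB8D`.

WHAT THIS MODULE PROVES (kernel, 0 sorry; `c : Node00.CubeB8D d L K Ω`; `𝔸` a non-trivial C⋆-algebra).
* ★ `c137_dentedMember_γ` — (1.42)₂ at all levels for `U₁ = U₀″^{u⁻¹}` at background `1` on every bond of the dented split class `c.lamBPT c.k j` (twin of `c137_cubeMember_γ`).
* ★★ `norms136_dentedMember_at_γ_d4` — the three norm members `|∇A|₍₋₂₎, |∂*∂A|₍₋₃₎, |ΔA|₍₋₃₎ ≤ 5dLB₀(L³α₀ + 6dL²Mα₀)` of (1.136)∕(152) on the dented tower for the canonical exponent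
  `A = mlogCfg c.k η c.sq (U₀″^{u⁻¹})`, from the socket `SockB9P3D4β L B₀ B_∂ c_{B9} η c.k c.sq c.lamST c.lamBPT` and the (1.62)-data of `u` (twin of `norms136_cubeMember_at_γ_d4`,
  statement with `cubeFam false ↦ c.sq`, `cubeLamS ↦ c.lamST` (`c.lamS` at the top), `cubeLamBP' ↦ c.lamBPT`, `(a, M, ρ, k) ↦ c`'s fields).
HONEST SCOPE ∕ A6.  CONDITIONAL on the displayed socket at the dented member (served downstream from the scalar (1.59) clauses — the named facts road); `≤` for print's `<`; `ℤᵈ`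
carriers; nothing of [4]∕[6]∕[15] asserted beyond the generic engines.  Count-neutral; N05 ∕ N07 NOT discharged; one finite `𝕋⁴` programme at fixed `ε`, Bałaban as printed; nothing
continuum ∕ ℝ⁴ ∕ OS ∕ mass-gap ∕ Clay.  No `sorry`, no `def`, no `instance`, no `notation`.  Unit `pub-ymgap-dag-n05-e` (g31), 2026-08-28.
-/

noncomputable section

open NormedSpace

namespace Literature.MathematicalPhysics.QuantumFieldTheory.Balaban1983to89.B8Prop6DentedCubeMemberNormsGamma

open MatrixLog B7Prop1Explicit B7Prop2Explicit B7Prop1Local B7Eq92Concrete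
open B7Prop2Explicit (C0 c2')
open B7Prop3Flat (c3)
open B7Prop4GeneralLevels (logCovIter linCovIter)
open B8Ineq132 (covDerivFwd InAk inAk_gaugeAct_iff BondTouches)
open B8Ineq133 (cutFixed)
open B8Lemma1NonAbelian (mulCfg)
open B8Eq115GaugeFixing (gaugeAct_mul gaugeAct_mem_of)
open B8Eq146AExpansion (iEta expCfg plaqCovDeriv)
open B8Eq143PlaqExpansion (pdiv)
open B8Eq184Proof (cfgExp)
open B8Eq140Level (SideTouches)
open B8Eq119TwistedAxial (InAx Restr129 restr129_level_zero)
open B8Eq155JBound (Jcur wsup)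
open B8ScaledSupNorm (bondNorm msup weight Bdd)
open B8Eq138LandauZd (IsLandau138W logCfg covLap)
open B8Eq131Cubes (tcube tLo tHi ctr)
open B8Ineq130 (gaugeAct_one)
open B8Eq131CubesAdmissible (cubeFam cubeFam_false_of_le)
open B8CubeMemberZd (cubeLamS cubeLam cubeLamS_top mem_cubeLam_zero_iff)
open B9SupplySockB9P3ZdLettersOmega (margin2_cubeFam)
open B9SupplySockB9P3ZdBeta (CrossB SockB9P3D4β)
open B8Prop6CubeMember (thm4_hypotheses_one_cutFixed regime_of_printed_smallness norm_cutFixed_sub_one_le)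
open B8Prop6DentedCubeMemberGamma (thm4_hypotheses_one_cutFixed_dented_γ)
open B8DentedCubeMemberZd (hΩ_sq lamST_top)
open B8DentedCubeMemberLamBPrime (lamBPT_hbox_pred lamBPT_hclass cubeLam_subset_lamS)
open Node00 (CubeB8D)
open B8Prop6OfThm4 (const_136)
open B8Prop3GaugeFixedKLevel (inAk_congr_of_sideTouches expCfg_iEta_eq_cfgExp)
open B8LeafModelZd3 (mlogCfg mlogCfg_spec mlogCfg_of_sideTouches mlogCfg_of_not prop3_windows)
open B9Eq340HolderZd (hquot AdmPair)
open B8Eq142KLevelLocalGamma (H42_of_inAx_γ)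
open B8Thm4KLevelGamma (norm_B1_lt_kLevel_γ)

-- `Site` alone could resolve to the torus sites of `Setup.lean`; re-export the `ℤ^d` sites of `B7Prop1Explicit`.
export B7Prop1Explicit (Site)

variable {d : ℕ}

variable {𝔸 : Type} [CStarAlgebra 𝔸] [Nontrivial 𝔸]

/-! ## §1 (1.42)₂ at all levels on print's split class, background `1` -/

/-- ★ **(1.42)₂ AT ALL LEVELS FOR `U₁ = U₀″^{u⁻¹}` AT BACKGROUND `1`, ON EVERY BOND OF THE SPLIT PRINT CLASS `cubeLamBP' … k j`** — dag-n05-e g6's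
`B8Prop6CubeMemberNorms.c137_cubeMember` re-run in edition γ: `H42_of_inAx_γ` at the Proposition-6 datum `(1, U₀″)` (unitarity, (1.33), (1.34) = (1.132), `Ax` at every
truncation, and (1.66) = (1.133) in PRINT's guard «box ⊂ □_{j−1}» by dag-n05-c's `thm4_hypotheses_one_cutFixed_γ`), class laws `cubeLamBP'_hbox_pred` ∕ `cubeLamBP'_hclass`
(`L ≤ ρ`), (1.29) w.r.t. `cubeLamS … k`, the exponent `A = mlogCfg` of the (1.62)-data; [3]-Prop.-4 windows ONE LEVEL LOWER, at `(L²·L³α₀, L·α₂)`.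
[cite: Balaban1985RegularSpaces, (1.42) p.83, (1.37) p.82, (1.31) p.82, (1.35) p.82, (1.133) p.99, p.77; Balaban1984PropagatorsII, (2.3) p.224] -/
theorem c137_dentedMember_γ (hd2 : 2 ≤ d) {L : ℕ} (hL : 2 ≤ L) {K : ℕ} {Ω : ℕ → Set (Site d)} (c : CubeB8D d L K Ω)
    (U₀ : Site d → Fin d → 𝔸ˣ) (hU₀ : ∀ x κ, U₀ x κ ∈ unitaryUnits 𝔸) {α₀ : ℝ} (hα : 0 < α₀)
    (hα3 : C0 d * (α₀ * (L : ℝ) ^ 2) ≤ 1 / 3) (hα2 : 2 * (α₀ * (L : ℝ) ^ 2) ≤ c2' d L)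
    {η : ℝ} (hη : 0 < η) (hA : InAk L c.k η α₀ Ω U₀)
    (hsmall : 11 * (d : ℝ) ^ 2 * (L : ℝ) ^ 2 * α₀ + ((c.M : ℝ) + 4 * c.ρ) * d * (L : ℝ) ^ 2 * α₀ ≤ 1 / 6)
    {α₂ : ℝ} (hα₂ : 0 ≤ α₂) (hα3' : C0 d * ((L : ℝ) ^ 2 * ((L : ℝ) ^ 3 * α₀)) ≤ 1 / 3) (hα4' : 4 * ((L : ℝ) ^ 2 * ((L : ℝ) ^ 3 * α₀)) ≤ c2' d L)
    (h16 : 16 * α₂ ≤ 1) (h16' : 16 * ((L : ℝ) * α₂) ≤ 1)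
    (hsm : Real.exp (4 * (800 * ((d : ℝ) + 1) ^ 2 * ((d : ℝ) + 4)) * ((L : ℝ) ^ 2 * ((L : ℝ) ^ 3 * α₀)))
      * (1 + 8 * (131072 * ((d : ℝ) + 1) ^ 2) * ((L : ℝ) * α₂)) ≤ 2)
    (hc₃ : 2 * ((L : ℝ) * α₂) ≤ c3 d L) (hsmall₁ : (d : ℝ) * L * (6 * d * (L : ℝ) ^ 2 * c.M * α₀) ≤ 1 / 8)
    (u : Site d → 𝔸ˣ) (hu : ∀ x, u x ∈ unitaryUnits 𝔸)
    (h129 : Restr129 L c.k (c.lamS) (1 : Site d → Fin d → 𝔸ˣ) u)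
    (h162 : ∀ j, j ≤ c.k → ∀ b ∈ {b : Site d × Fin d | SideTouches (c.sq j) b.1 b.2},
      gaugeAct u⁻¹ (cutFixed L (tLo c.a c.ρ) (tHi c.a c.M c.ρ) U₀ c.k (ctr c.a c.M)) b.1 b.2 =
          cfgExp η (logCfg η (gaugeAct u⁻¹ (cutFixed L (tLo c.a c.ρ) (tHi c.a c.M c.ρ) U₀ c.k (ctr c.a c.M)))) b.1 b.2 ∧
        IsSelfAdjoint (logCfg η (gaugeAct u⁻¹ (cutFixed L (tLo c.a c.ρ) (tHi c.a c.M c.ρ) U₀ c.k (ctr c.a c.M))) b.1 b.2) ∧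
        ‖logCfg η (gaugeAct u⁻¹ (cutFixed L (tLo c.a c.ρ) (tHi c.a c.M c.ρ) U₀ c.k (ctr c.a c.M))) b.1 b.2‖ ≤ α₂ * ((L : ℝ) ^ j * η)⁻¹) :
    ∀ j, j ≤ c.k → ∀ b ∈ c.lamBPT c.k j,
      ‖logCovIter L (1 : Site d → Fin d → 𝔸ˣ)
          (iEta η (mlogCfg c.k η c.sq (gaugeAct u⁻¹ (cutFixed L (tLo c.a c.ρ) (tHi c.a c.M c.ρ) U₀ c.k (ctr c.a c.M)))))
          j b.1 b.2‖ < 2 * d * L * (6 * d * (L : ℝ) ^ 2 * c.M * α₀) := by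
  have hL1 : 1 ≤ L := le_trans (by norm_num) hL
  have hd1 : 1 ≤ d := le_trans (by norm_num) hd2
  have hk : 1 ≤ c.k := c.one_le_k
  have hρL : L ≤ c.ρ := c.L_le_ρ
  have hρ : 1 ≤ c.ρ := hL1.trans hρL
  have hM1 : 1 ≤ c.M := hρ.trans c.ρ_le_M
  have hLpos : (0 : ℝ) < L := by exact_mod_cast hL1
  have hdpos : (0 : ℝ) < d := by exact_mod_cast hd1
  have hMpos : (0 : ℝ) < c.M := by exact_mod_cast hM1
  have hα₀' : 0 < (L : ℝ) ^ 3 * α₀ := by positivity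
  have hα₁' : 0 < 6 * d * (L : ℝ) ^ 2 * c.M * α₀ := by positivity
  set U'' := cutFixed L (tLo c.a c.ρ) (tHi c.a c.M c.ρ) U₀ c.k (ctr c.a c.M) with hU''
  obtain ⟨hmem, h33, h34, hAx, h135, -⟩ :=
    thm4_hypotheses_one_cutFixed_dented_γ hL hd1 c U₀ hU₀ hα hα3 hα2 hη hA hsmall
  have hone : ∀ x κ, (1 : Site d → Fin d → 𝔸ˣ) x κ ∈ unitaryUnits 𝔸 := fun _ _ => (unitaryUnits 𝔸).one_mem
  have hU₁u : ∀ x κ, gaugeAct u⁻¹ U'' x κ ∈ unitaryUnits 𝔸 :=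
    gaugeAct_mem_of hmem fun x => (unitaryUnits 𝔸).inv_mem (hu x)
  -- the canonical exponent: Hermitian, `= (1/iη) log U₁` on the `E j`, `U₁ = e^{iηA}` there, `0` off them
  obtain ⟨hsa, hrep, hzero⟩ := mlogCfg_spec hη hL1 c.k (1 : Site d → Fin d → 𝔸ˣ) hU₁u hα₂ h16 c.sq
    (fun j hj y τ hs => ⟨(h162 j hj (y, τ) hs).1, (h162 j hj (y, τ) hs).2.2⟩)
  have hWA : ∀ j, j ≤ c.k → ∀ y τ, SideTouches (c.sq j) y τ →
      gaugeAct u⁻¹ U'' y τ = cfgExp η (mlogCfg c.k η c.sq (gaugeAct u⁻¹ U'')) y τ ∧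
        ‖mlogCfg c.k η c.sq (gaugeAct u⁻¹ U'') y τ‖ ≤ α₂ * ((L : ℝ) ^ j * η)⁻¹ := fun j hj y τ hs =>
    ⟨(hrep j hj y τ hs).2, by rw [(hrep j hj y τ hs).1]; exact (h162 j hj (y, τ) hs).2.2⟩
  -- `U₁^{u} = U₀″`
  have hgU : mgauge (1 : Site d → Fin d → 𝔸ˣ) u (gaugeAct u⁻¹ U'') = U'' := by
    rw [mgauge_one_left, ← gaugeAct_mul, mul_inv_cancel, gaugeAct_one]
  have h129' : Restr129 L c.k (c.lamST c.k) (1 : Site d → Fin d → 𝔸ˣ) u := by rw [lamST_top c]; exact h129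
  exact H42_of_inAx_γ hd2 hη hL c.k hone hα₀' hα₁' hα₂ hα3' hα4' h16' hsm hc₃ hsmall₁ c.sq
    (hΩ_sq c) c.lamST c.lamBPT (lamBPT_hbox_pred c hL1) (lamBPT_hclass c hL1)
    h33 h34 hAx h135 (fun _ _ => True) c.k hk le_rfl u (gaugeAct u⁻¹ U'') _ hu hgU h129' trivial hsa hWA hzero

#print axioms c137_dentedMember_γ

/-! ## §2 Proposition 3's norm members at the cube member from the FOUR-LINE socket over the split print class, EDITION γ -/

/-- ★★ **PROPOSITION 3 (p. 87) AT THE DENTED CUBE MEMBER (`CubeB8D`, [15] (148)–(150)), BACKGROUND `1`: THE NORM MEMBERS OF (1.136) FROM THE FOUR-LINE COLLAR SOCKET OVER PRINT's SPLIT CLASS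
`cubeLamBP'`, EDITION γ** — dag-n05-e's `B8Prop6CubeMemberBdryBeta.norms136_cubeMember_at_bdryβ_d4` (four lines: `|A′|_(−1)`, `|∇A′|_(−2)`, `|∂*∂A′|_(−3)`, `|ΔA′|_(−3)`
on the touching bonds, each `≤ B₀(|J|_(−3) + |B₁|) + B_∂·Φ₀(A′)`) with the averaging datum `|B₁|` = `sup` of `‖LʲηQ_j(iηA′)(c)‖` over `{(j, c) : c ∈ cubeLamBP' … k j}` ∪
`{(0, c) : c a CROSSING bond of □₀}` — the socket `SockB9P3D4β L B₀ B_∂ c_{B9} η k (cubeFam …) (cubeLamS …) (cubeLamBP' …)` BY NAME — and the collar `Φ₀` over the outer sides;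
support clause «`u = 1` off `□₀`», `0 ≤ B_∂`, `4B_∂ ≤ (dL − 1)B₀`; SAME conclusions (`5dLB₀·s`, `s = α₀′ + α₁′`, for the three members).  The slot «|B₁| < 2dLα₁ + C₂α₂²»:
on the class by (1.42)₂ at every level (§1) + (1.56) one level lower (`norm_B1_lt_kLevel_γ`, constant `8·131072(d+1)²·e^{…L²α₀′}·L²·α₂² ≤ C₂α₂²` for
`C₂ ≥ 2097152(d+1)²L²`); on a level-0 crossing term `η‖A′(b)‖ ≤ 2α₁′` (`u = 1` at both end-points).  Thresholds asked at `(L²α₀′, Lα₂)`.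
[cite: Balaban1985RegularSpaces, Prop. 3 p.87, Prop. 6 (1.136) p.99, (1.29) p.81, (1.31) p.82, (1.42) p.83, (1.56)–(1.61) p.86, (1.133) p.99, p.77; Balaban1985BackgroundPropagators, (3.16) p.393; Balaban1984PropagatorsII, (2.3) p.224] -/
theorem norms136_dentedMember_at_γ_d4 (hd2 : 2 ≤ d) {L : ℕ} (hL : 2 ≤ L) {B₀ C₂ cB9 Bbd : ℝ} (hB₀ : 0 < B₀)
    (hC₂ : 2097152 * ((d : ℝ) + 1) ^ 2 * (L : ℝ) ^ 2 ≤ C₂) (hcB9 : 0 < cB9) (hBbd : 0 ≤ Bbd) (hBd : 4 * Bbd ≤ ((d : ℝ) * L - 1) * B₀) :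
    ∃ c₀ : ℝ, 0 < c₀ ∧ ∀ (η : ℝ), 0 < η → ∀ {K : ℕ} {Ω : ℕ → Set (Site d)} (c : CubeB8D d L K Ω),
      -- the Prop.-3-frame b9 socket AT THE DENTED MEMBER over PRINT's split class, four lines (β shape), by name
      SockB9P3D4β (𝔸 := 𝔸) L B₀ Bbd cB9 η c.k c.sq c.lamST c.lamBPT →
      ∀ (U₀ : Site d → Fin d → 𝔸ˣ), (∀ x κ, U₀ x κ ∈ unitaryUnits 𝔸) → ∀ (α₀ : ℝ), 0 < α₀ →
      C0 d * (α₀ * (L : ℝ) ^ 2) ≤ 1 / 3 → 2 * (α₀ * (L : ℝ) ^ 2) ≤ c2' d L →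
      InAk L c.k η α₀ Ω U₀ →
      11 * (d : ℝ) ^ 2 * (L : ℝ) ^ 2 * α₀ + ((c.M : ℝ) + 4 * c.ρ) * d * (L : ℝ) ^ 2 * α₀ ≤ 1 / 6 →
      (L : ℝ) ^ 2 * ((L : ℝ) ^ 3 * α₀) ≤ c₀ → (L : ℝ) * (5 * (d : ℝ) * L * B₀ * ((L : ℝ) ^ 3 * α₀ + 6 * d * (L : ℝ) ^ 2 * c.M * α₀)) ≤ c₀ →
      2 * (5 * (d : ℝ) * L * B₀ * ((L : ℝ) ^ 3 * α₀ + 6 * d * (L : ℝ) ^ 2 * c.M * α₀)) ^ 2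
        + 20 * d * ((L : ℝ) ^ 3 * α₀) * (5 * (d : ℝ) * L * B₀ * ((L : ℝ) ^ 3 * α₀ + 6 * d * (L : ℝ) ^ 2 * c.M * α₀))
        + 2 * C₂ * (5 * (d : ℝ) * L * B₀ * ((L : ℝ) ^ 3 * α₀ + 6 * d * (L : ℝ) ^ 2 * c.M * α₀)) ^ 2
        ≤ (L : ℝ) ^ 3 * α₀ + 6 * d * (L : ℝ) ^ 2 * c.M * α₀ →
      (d : ℝ) * L * (6 * d * (L : ℝ) ^ 2 * c.M * α₀) ≤ 1 / 8 →
      ∀ (u : Site d → 𝔸ˣ), (∀ x, u x ∈ unitaryUnits 𝔸) → (∀ x, x ∉ c.sq 0 → u x = 1) →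
      Restr129 L c.k (c.lamS) (1 : Site d → Fin d → 𝔸ˣ) u →
      IsLandau138W L c.k η (c.sq 0) (c.lamS) (1 : Site d → Fin d → 𝔸ˣ)
        (gaugeAct u⁻¹ (cutFixed L (tLo c.a c.ρ) (tHi c.a c.M c.ρ) U₀ c.k (ctr c.a c.M))) →
      (∀ j, j ≤ c.k → ∀ b ∈ {b : Site d × Fin d | SideTouches (c.sq j) b.1 b.2},
        gaugeAct u⁻¹ (cutFixed L (tLo c.a c.ρ) (tHi c.a c.M c.ρ) U₀ c.k (ctr c.a c.M)) b.1 b.2 =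
            cfgExp η (logCfg η (gaugeAct u⁻¹ (cutFixed L (tLo c.a c.ρ) (tHi c.a c.M c.ρ) U₀ c.k (ctr c.a c.M)))) b.1 b.2 ∧
          IsSelfAdjoint (logCfg η (gaugeAct u⁻¹ (cutFixed L (tLo c.a c.ρ) (tHi c.a c.M c.ρ) U₀ c.k (ctr c.a c.M))) b.1 b.2) ∧
          ‖logCfg η (gaugeAct u⁻¹ (cutFixed L (tLo c.a c.ρ) (tHi c.a c.M c.ρ) U₀ c.k (ctr c.a c.M))) b.1 b.2‖ ≤
            (5 * (d : ℝ) * L * B₀ * ((L : ℝ) ^ 3 * α₀ + 6 * d * (L : ℝ) ^ 2 * c.M * α₀)) * ((L : ℝ) ^ j * η)⁻¹) →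
      msup L c.k η (-(2 : ℝ)) (fun j (t : Fin d × Fin d × Site d) => SideTouches (c.sq j) t.2.2 t.2.1)
          (fun t => covDerivFwd η (1 : Site d → Fin d → 𝔸ˣ) t.1 (fun z => mlogCfg c.k η c.sq
            (gaugeAct u⁻¹ (cutFixed L (tLo c.a c.ρ) (tHi c.a c.M c.ρ) U₀ c.k (ctr c.a c.M))) z t.2.1) t.2.2)
        ≤ 5 * (d : ℝ) * L * B₀ * ((L : ℝ) ^ 3 * α₀ + 6 * d * (L : ℝ) ^ 2 * c.M * α₀) ∧
      bondNorm L c.k η (-(3 : ℝ)) c.sq (fun x μ => pdiv η (1 : Site d → Fin d → 𝔸ˣ)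
          (plaqCovDeriv η (1 : Site d → Fin d → 𝔸ˣ) (mlogCfg c.k η c.sq
            (gaugeAct u⁻¹ (cutFixed L (tLo c.a c.ρ) (tHi c.a c.M c.ρ) U₀ c.k (ctr c.a c.M))))) μ x)
        ≤ 5 * (d : ℝ) * L * B₀ * ((L : ℝ) ^ 3 * α₀ + 6 * d * (L : ℝ) ^ 2 * c.M * α₀) ∧
      bondNorm L c.k η (-(3 : ℝ)) c.sq (fun x μ => covLap η (1 : Site d → Fin d → 𝔸ˣ)
          (fun z => mlogCfg c.k η c.sq (gaugeAct u⁻¹ (cutFixed L (tLo c.a c.ρ) (tHi c.a c.M c.ρ) U₀ c.k (ctr c.a c.M))) z μ) x)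
        ≤ 5 * (d : ℝ) * L * B₀ * ((L : ℝ) ^ 3 * α₀ + 6 * d * (L : ℝ) ^ 2 * c.M * α₀) := by
  have hL1 : 1 ≤ L := le_trans (by norm_num) hL
  have hd1 : 1 ≤ d := le_trans (by norm_num) hd2
  obtain ⟨cw, hcw, hwin⟩ := prop3_windows hd2 hL hB₀.le
  refine ⟨min cB9 cw, lt_min hcB9 hcw, ?_⟩
  intro η hη K Ω c SB9D U₀ hU₀ α₀ hα hα3 hα2 hA hsmall hc₀ hc₂ h61 hsmall₁ u hu huS h129 hLan h162
  have hk : 1 ≤ c.k := c.one_le_k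
  have hρL : L ≤ c.ρ := c.L_le_ρ
  have hρM : c.ρ ≤ c.M := c.ρ_le_M
  have hM : 11 * (d : ℝ) < c.M := by exact_mod_cast c.big
  have hρ : 1 ≤ c.ρ := hL1.trans hρL
  have hM1 : 1 ≤ c.M := hρ.trans hρM
  have hLr : (1 : ℝ) ≤ L := by exact_mod_cast hL1
  have hdpos : (0 : ℝ) < d := by exact_mod_cast hd1
  have hMpos : (0 : ℝ) < c.M := by exact_mod_cast hM1
  set α₀' : ℝ := (L : ℝ) ^ 3 * α₀ with hα₀'_def
  set α₁' : ℝ := 6 * d * (L : ℝ) ^ 2 * c.M * α₀ with hα₁'_def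
  set α₂ : ℝ := 5 * (d : ℝ) * L * B₀ * ((L : ℝ) ^ 3 * α₀ + 6 * d * (L : ℝ) ^ 2 * c.M * α₀) with hα₂_def
  have hα₀' : 0 < α₀' := by positivity
  have hα₁' : 0 < α₁' := by positivity
  have hα₂ : 0 < α₂ := by positivity
  -- the thresholds at `(α₀′, α₂)` follow from those at `(L²α₀′, Lα₂)` (`L ≥ 1`)
  have hL2 : (1 : ℝ) ≤ (L : ℝ) ^ 2 := one_le_pow₀ hLr
  have hc₀' : α₀' ≤ min cB9 cw := (le_mul_of_one_le_left hα₀'.le hL2).trans hc₀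
  have hc₂' : α₂ ≤ min cB9 cw := (le_mul_of_one_le_left hα₂.le hLr).trans hc₂
  have hLα₀' : 0 < (L : ℝ) ^ 2 * α₀' := by positivity
  have hLα₂ : 0 ≤ (L : ℝ) * α₂ := by positivity
  obtain ⟨hα3', hα4', h16, hd5, hsm, hc₃, hside, h50, hC⟩ :=
    hwin α₀' α₂ hα₀' (hc₀'.trans (min_le_right _ _)) hα₂.le (hc₂'.trans (min_le_right _ _))
  obtain ⟨hα3γ, hα4γ, h16γ, -, hsmγ, hc₃γ, -, -, hCγ⟩ :=
    hwin ((L : ℝ) ^ 2 * α₀') ((L : ℝ) * α₂) hLα₀' (hc₀.trans (min_le_right _ _)) hLα₂ (hc₂.trans (min_le_right _ _))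
  set U'' := cutFixed L (tLo c.a c.ρ) (tHi c.a c.M c.ρ) U₀ c.k (ctr c.a c.M) with hU''
  obtain ⟨hmem, h33, h34, -, -, -⟩ := thm4_hypotheses_one_cutFixed_dented_γ hL hd1 c U₀ hU₀ hα hα3 hα2 hη hA hsmall
  have hone : ∀ x κ, (1 : Site d → Fin d → 𝔸ˣ) x κ ∈ unitaryUnits 𝔸 := fun _ _ => (unitaryUnits 𝔸).one_mem
  have hui : ∀ x, u⁻¹ x ∈ U1 𝔸 := fun x => unitaryUnits_le_U1 ((unitaryUnits 𝔸).inv_mem (hu x))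
  have hU₁u : ∀ x κ, gaugeAct u⁻¹ U'' x κ ∈ unitaryUnits 𝔸 := gaugeAct_mem_of hmem fun x => (unitaryUnits 𝔸).inv_mem (hu x)
  set W : Site d → Fin d → 𝔸ˣ := gaugeAct u⁻¹ U'' with hW_def
  set A : Site d → Fin d → 𝔸 := mlogCfg c.k η c.sq W with hA_def
  -- the canonical exponent: Hermitian, (1.41), `W = e^{iηA}` on the `E j`, `0` off them
  obtain ⟨hAsa, hrep, hA0⟩ := mlogCfg_spec hη hL1 c.k (1 : Site d → Fin d → 𝔸ˣ) hU₁u hα₂.le h16 c.sq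
    (fun j hj y τ hs => ⟨(h162 j hj (y, τ) hs).1, (h162 j hj (y, τ) hs).2.2⟩)
  have h41 : ∀ j, j ≤ c.k → ∀ (y : Site d) (τ : Fin d), SideTouches (c.sq j) y τ →
      W y τ = cfgExp η A y τ ∧ ‖A y τ‖ ≤ α₂ * ((L : ℝ) ^ j * η)⁻¹ := fun j hj y τ hs =>
    ⟨(hrep j hj y τ hs).2, by rw [hA_def, (hrep j hj y τ hs).1]; exact (h162 j hj (y, τ) hs).2.2⟩
  have h41' : ∀ j, j ≤ c.k → ∀ (y : Site d) (τ : Fin d), SideTouches (c.sq j) y τ →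
      ‖A y τ‖ ≤ α₂ * ((L : ℝ) ^ j * η)⁻¹ := fun j hj y τ hs => (h41 j hj y τ hs).2
  -- (1.40)₂ for `W·1` by gauge invariance from (1.132), and for `e^{iηA}·1` by locality
  have hW₀ : mulCfg U'' (1 : Site d → Fin d → 𝔸ˣ) = U'' := mul_one _
  have hW₁ : mulCfg W (1 : Site d → Fin d → 𝔸ˣ) = W := mul_one _
  have hPair : InAk L c.k η α₀' c.sq (mulCfg W (1 : Site d → Fin d → 𝔸ˣ)) := by
    rw [hW₁, hW_def, inAk_gaugeAct_iff L c.k η _ _ hui]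
    rw [hW₀] at h34
    exact h34
  have h40₁ : InAk L c.k η α₀' c.sq (mulCfg (expCfg (iEta η A)) (1 : Site d → Fin d → 𝔸ˣ)) := by
    refine (inAk_congr_of_sideTouches L c.k η α₀' (V := mulCfg W (1 : Site d → Fin d → 𝔸ˣ)) fun j hj y τ hs => ?_).1 hPair
    show W y τ * (1 : Site d → Fin d → 𝔸ˣ) y τ = expCfg (iEta η A) y τ * (1 : Site d → Fin d → 𝔸ˣ) y τ
    rw [(h41 j hj y τ hs).1, expCfg_iEta_eq_cfgExp]
  have hAglob : ∀ y τ, ‖A y τ‖ ≤ α₂ * η⁻¹ := by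
    intro y τ
    by_cases hmem' : ∃ j, j ≤ c.k ∧ SideTouches (c.sq j) y τ
    · obtain ⟨j, hj, hs⟩ := hmem'
      have hLj : (1 : ℝ) ≤ (L : ℝ) ^ j := one_le_pow₀ hLr
      calc ‖A y τ‖ ≤ α₂ * ((L : ℝ) ^ j * η)⁻¹ := h41' j hj y τ hs
        _ = α₂ * η⁻¹ * ((L : ℝ) ^ j)⁻¹ := by rw [mul_inv]; ring
        _ ≤ α₂ * η⁻¹ * 1 := by
            apply mul_le_mul_of_nonneg_left (inv_le_one_of_one_le₀ hLj) (by positivity)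
        _ = α₂ * η⁻¹ := mul_one _
    · rw [hA_def, hA0 y τ fun j hj hs => hmem' ⟨j, hj, hs⟩, norm_zero]
      positivity
  have hgrad : ∀ (y : Site d) (κ τ : Fin d), ‖covDerivFwd η (1 : Site d → Fin d → 𝔸ˣ) κ (fun z => A z τ) y‖ ≤ 2 * α₂ * η⁻¹ * η⁻¹ := by
    intro y κ τ
    unfold covDerivFwd
    rw [norm_smul, norm_inv, Real.norm_eq_abs, abs_of_pos hη]
    have h1 : ‖B7Eq78Linearization.conjR ((1 : Site d → Fin d → 𝔸ˣ) y κ) (A (y + e κ) τ) - A y τ‖ ≤ α₂ * η⁻¹ + α₂ * η⁻¹ := by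
      calc ‖B7Eq78Linearization.conjR ((1 : Site d → Fin d → 𝔸ˣ) y κ) (A (y + e κ) τ) - A y τ‖
          ≤ ‖B7Eq78Linearization.conjR ((1 : Site d → Fin d → 𝔸ˣ) y κ) (A (y + e κ) τ)‖ + ‖A y τ‖ := norm_sub_le _ _
        _ ≤ α₂ * η⁻¹ + α₂ * η⁻¹ := by
            rw [B8Ineq132.norm_conjR (unitaryUnits_le_U1 (hone y κ))]
            exact add_le_add (hAglob _ _) (hAglob _ _)
    calc η⁻¹ * ‖B7Eq78Linearization.conjR ((1 : Site d → Fin d → 𝔸ˣ) y κ) (A (y + e κ) τ) - A y τ‖ ≤ η⁻¹ * (α₂ * η⁻¹ + α₂ * η⁻¹) :=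
        mul_le_mul_of_nonneg_left h1 (by positivity)
      _ = 2 * α₂ * η⁻¹ * η⁻¹ := by ring
  have hBg : Bdd L c.k η (-(2 : ℝ)) (fun j (t : Fin d × Fin d × Site d) => SideTouches (c.sq j) t.2.2 t.2.1)
      (fun t => covDerivFwd η (1 : Site d → Fin d → 𝔸ˣ) t.1 (fun z => A z t.2.1) t.2.2) := by
    have e2 : (-(2 : ℝ)) = -((2 : ℕ) : ℝ) := by norm_num
    rw [e2]
    refine B8ScaledSupNorm.bdd_of_forall (c := 2 * α₂ * ((L : ℝ) ^ c.k) ^ 2) fun j hj t _ => ?_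
    rw [B8ScaledSupNorm.weight_neg_natCast L η 2 j]
    have hLjk : (L : ℝ) ^ j ≤ (L : ℝ) ^ c.k := pow_le_pow_right₀ hLr hj
    have hLj0 : (0 : ℝ) ≤ (L : ℝ) ^ j := by positivity
    calc ((L : ℝ) ^ j * η) ^ 2 * ‖covDerivFwd η (1 : Site d → Fin d → 𝔸ˣ) t.1 (fun z => A z t.2.1) t.2.2‖
        ≤ ((L : ℝ) ^ j * η) ^ 2 * (2 * α₂ * η⁻¹ * η⁻¹) := mul_le_mul_of_nonneg_left (hgrad _ _ _) (by positivity)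
      _ = 2 * α₂ * ((L : ℝ) ^ j) ^ 2 := by field_simp
      _ ≤ 2 * α₂ * ((L : ℝ) ^ c.k) ^ 2 := by gcongr
  set g : ℝ := msup L c.k η (-(2 : ℝ)) (fun j (t : Fin d × Fin d × Site d) => SideTouches (c.sq j) t.2.2 t.2.1)
      (fun t => covDerivFwd η (1 : Site d → Fin d → 𝔸ˣ) t.1 (fun z => A z t.2.1) t.2.2) with hg_def
  have hg0 : 0 ≤ g := B8ScaledSupNorm.msup_nonneg L c.k hη.le _ _ _
  have hg : ∀ j, j ≤ c.k → ∀ (y : Site d) (κ τ : Fin d), SideTouches (c.sq j) y τ →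
      ((L : ℝ) ^ j * η) ^ 2 * ‖covDerivFwd η (1 : Site d → Fin d → 𝔸ˣ) κ (fun z => A z τ) y‖ ≤ g := by
    intro j hj y κ τ hs
    have h := B8ScaledSupNorm.weight_mul_norm_le_msup hBg hj (i := (κ, τ, y)) hs
    have hw : weight L η (-(2 : ℝ)) j = ((L : ℝ) ^ j * η) ^ 2 := by
      have e2 : (-(2 : ℝ)) = -((2 : ℕ) : ℝ) := by norm_num
      rw [e2, B8ScaledSupNorm.weight_neg_natCast L η 2 j]
    rw [hw] at h
    exact h
  -- the in-edge (1.59), four lines, from the socket AT THE MEMBER over print's split class (by name)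
  have hLan' : IsLandau138W L c.k η (c.sq 0) (c.lamST c.k) (1 : Site d → Fin d → 𝔸ˣ) W := by rw [lamST_top c]; exact hLan
  obtain ⟨h59a, h59g, h59j, h59l⟩ := SB9D α₀' α₂ hα₀' (hc₀'.trans (min_le_left _ _)) hα₂ (hc₂'.trans (min_le_left _ _))
    (1 : Site d → Fin d → 𝔸ˣ) W hone hU₁u h33 hPair hLan' A hAsa h41 hA0
  -- (1.42)₂ at all levels on the split class (§1) and its γ box law
  have h42 := c137_dentedMember_γ hd2 hL c U₀ hU₀ hα hα3 hα2 hη hA hsmall hα₂.le hα3γ hα4γ h16 h16γ hsmγ hc₃γ hsmall₁ u hu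
    h129 h162
  have hbox : ∀ j, j ≤ c.k → ∀ b ∈ c.lamBPT c.k j, ∀ x, InBox (loK L j b.1) (bondHiK L j b.1 b.2) x → x ∈ c.sq (j - 1) :=
    fun j hj b hb x hx => lamBPT_hbox_pred c hL1 c.k le_rfl j hj b hb x hx
  -- `u = 1` AT EVERY SITE OF `□₀` WITH A NEIGHBOUR (sup-distance ≤ 2) OUTSIDE `□₀`: such a site is not in `□₁` (margin of (1.131)), hence lies in
  -- `Λ₀ = □₀ ∖ □₁`, where (1.29) at level 0 pins `u = 1`
  have hM2 := margin2_cubeFam L c.a c.M (hL.trans hρL) c.k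
  have hlayer : ∀ y z : Site d, y ∈ c.sq 0 → z ∉ c.sq 0 →
      (∀ i, y i - 2 ≤ z i ∧ z i ≤ y i + 2) → u y = 1 := by
    intro y z hy hz hyz
    rw [c.sq_zero, ← B8Eq131CubesAdmissible.cubeFam_false_zero L c.a c.M c.ρ c.k] at hy hz
    have hy1 : y ∉ cubeFam false L c.a c.M c.ρ c.k 1 := fun h1 => hz (hM2 1 le_rfl y h1 z hyz)
    have hy0 : y ∈ B8CubeMemberZd.cubeLam L c.a c.M c.ρ c.k 0 := by
      rw [mem_cubeLam_zero_iff hL1 c.a c.M c.ρ hk, ← cubeFam_false_of_le L c.a c.M c.ρ (Nat.zero_le c.k), ← cubeFam_false_of_le L c.a c.M c.ρ hk]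
      exact ⟨hy, hy1⟩
    have hyS : y ∈ c.lamS 0 := cubeLam_subset_lamS c hk hy0
    exact Units.val_eq_one.mp (restr129_level_zero h129 hyS)
  -- ON A TOUCHING SIDE OF `□₀` NOT HAVING BOTH END-POINTS IN `□₀` (an outer side, or a CROSSING bond): `u = 1` at both end-points, so `W = U₀″`
  -- there and `η‖A‖ = ‖log U₀″‖ ≤ 2‖U₀″ − 1‖ ≤ 2·6dL²Mα₀` by (1.133)₀ read on every bond (`norm_cutFixed_sub_one_le`)
  have hcol : ∀ b : Site d × Fin d, SideTouches (c.sq 0) b.1 b.2 →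
      ¬ (b.1 ∈ c.sq 0 ∧ b.1 + e b.2 ∈ c.sq 0) → η * ‖A b.1 b.2‖ ≤ 2 * α₁' := by
    intro b hsd hnb
    have he1 : ∀ i, b.1 i - 2 ≤ (b.1 + e b.2) i ∧ (b.1 + e b.2) i ≤ b.1 i + 2 := by
      intro i
      simp only [Pi.add_apply, e_apply]
      split_ifs <;> constructor <;> omega
    have he2 : ∀ i, (b.1 + e b.2) i - 2 ≤ b.1 i ∧ b.1 i ≤ (b.1 + e b.2) i + 2 := by
      intro i
      simp only [Pi.add_apply, e_apply]
      split_ifs <;> constructor <;> omega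
    have hx : u b.1 = 1 := by
      by_cases h : b.1 ∈ c.sq 0
      · exact hlayer b.1 (b.1 + e b.2) h (fun h' => hnb ⟨h, h'⟩) he1
      · exact huS _ h
    have hxe : u (b.1 + e b.2) = 1 := by
      by_cases h : b.1 + e b.2 ∈ c.sq 0
      · exact hlayer (b.1 + e b.2) b.1 h (fun h' => hnb ⟨h', h⟩) he2
      · exact huS _ h
    have hWb : W b.1 b.2 = U'' b.1 b.2 := by
      show gaugeAct u⁻¹ U'' b.1 b.2 = U'' b.1 b.2
      simp only [gaugeAct, Pi.inv_apply, hx, hxe, inv_one, one_mul, mul_one]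
    have hAb : A b.1 b.2 = logCfg η W b.1 b.2 := mlogCfg_of_sideTouches η W (Nat.zero_le c.k) hsd
    have hUb : ‖((U'' b.1 b.2 : 𝔸ˣ) : 𝔸) - 1‖ ≤ α₁' :=
      norm_cutFixed_sub_one_le L hL hd1 (avgClosed_unitaryUnits (𝔸 := 𝔸) d L) c.k U₀ hU₀ hα hα3 hα2 c.a hρ hρM hM hA c.tcube_sub hsmall b.1 b.2
    have hU1 : ‖((U'' b.1 b.2 : 𝔸ˣ) : 𝔸) - 1‖ ≤ 1 / 2 := hUb.trans (by
      have hdL1 : (1 : ℝ) ≤ (d : ℝ) * L := one_le_mul_of_one_le_of_one_le (by exact_mod_cast hd1) hLr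
      have h1 : α₁' ≤ (d : ℝ) * L * α₁' := le_mul_of_one_le_left hα₁'.le hdL1
      linarith [hsmall₁])
    rw [hAb, logCfg, hWb, norm_smul, norm_smul, norm_inv, norm_inv, Complex.norm_I, inv_one, one_mul, Real.norm_eq_abs,
      abs_of_pos hη, ← mul_assoc, mul_inv_cancel₀ hη.ne', one_mul]
    exact (MatrixLog.norm_mlog_le_two_mul hU1).trans (by linarith [hUb])
  -- THE COLLAR TERM `Φ₀(A′)` (outer sides: both end-points outside `□₀`) `≤ 2α₁′`
  set Φ₀ : ℝ := msup L c.k η (-(1 : ℝ))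
      (fun j (b : Site d × Fin d) => j = 0 ∧ SideTouches (c.sq 0) b.1 b.2 ∧ ¬ BondTouches (c.sq 0) b.1 b.2)
      (fun b => A b.1 b.2) with hΦ₀_def
  have hΦ₀ : Φ₀ ≤ 2 * α₁' := by
    refine B8ScaledSupNorm.msup_le (by positivity) fun j hj b hb => ?_
    obtain ⟨rfl, hsd, hnb⟩ := hb
    have e1 : (-(1 : ℝ)) = -((1 : ℕ) : ℝ) := by norm_num
    rw [e1, B8ScaledSupNorm.weight_neg_natCast L η 1 0, pow_one, pow_zero, one_mul]
    exact hcol b hsd fun h => hnb (Or.inl h.1)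
  have hΦ₀0 : 0 ≤ Φ₀ := B8ScaledSupNorm.msup_nonneg L c.k hη.le _ _ _
  -- the window: `2·Bbd·Φ₀ ≤ 4·Bbd·α₁′ ≤ (dL − 1)B₀(α₀′ + α₁′)`
  have hβ : Bbd * Φ₀ + Bbd * Φ₀ ≤ ((d : ℝ) * L - 1) * B₀ * (α₀' + α₁') := by
    have h1 : Bbd * Φ₀ + Bbd * Φ₀ ≤ 4 * Bbd * α₁' := by
      have h := mul_le_mul_of_nonneg_left hΦ₀ hBbd
      linarith
    have h2 : 4 * Bbd * α₁' ≤ ((d : ℝ) * L - 1) * B₀ * α₁' := mul_le_mul_of_nonneg_right hBd hα₁'.le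
    have h3 : 0 ≤ ((d : ℝ) * L - 1) * B₀ := le_trans (by positivity) hBd
    have h4 : ((d : ℝ) * L - 1) * B₀ * α₁' ≤ ((d : ℝ) * L - 1) * B₀ * (α₀' + α₁') :=
      mul_le_mul_of_nonneg_left (le_add_of_nonneg_left hα₀'.le) h3
    linarith
  -- PROPOSITION 3 at `k` levels with the allowances (dag-n05-e's `B8Prop3KLevelBdry`), then the slack absorbs them
  have h₀ : ∀ y κ, (1 : Site d → Fin d → 𝔸ˣ) y κ ∈ U1 𝔸 := fun y κ => unitaryUnits_le_U1 (hone y κ)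
  have h55 := B8Eq155KLevelLocal.eq155_norm_kLevel_hermitian hη hL1 h₀ hAsa hα₀'.le hα₂.le h16 hd5 hg0 h33 h40₁ h41' hg
  have h41'' : ∀ j, j ≤ c.k → ∀ x μ, BondTouches (c.sq j) x μ → ‖A x μ‖ ≤ α₂ * ((L : ℝ) ^ j * η)⁻¹ :=
    fun j hj x μ hb => B8Prop3KLevel.bound_of_sideTouches hd2 (h41' j hj) x μ hb
  -- «|B₁| < 2dLα₁ + C₂α₂²»: on the split print class by (1.42)₂ (§1) + (1.56) ONE LEVEL LOWER (`norm_B1_lt_kLevel_γ`, box law «box ⊂ □_{j−1}»);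
  -- on a level-0 CROSSING bond `Q₀ = 1`, the term is `η‖A′(b)‖ ≤ 2α₁′ ≤ 2dLα₁′` (`hcol`) — print's «B on Λ₀»
  have hdL : (1 : ℝ) ≤ (d : ℝ) * L := one_le_mul_of_one_le_of_one_le (by exact_mod_cast hd1) hLr
  set Cγ : ℝ := 8 * (131072 * ((d : ℝ) + 1) ^ 2) * Real.exp (4 * (800 * ((d : ℝ) + 1) ^ 2 * ((d : ℝ) + 4)) * ((L : ℝ) ^ 2 * α₀')) * (L : ℝ) ^ 2
    with hCγ_def
  have hC0 : 0 ≤ Cγ * α₂ ^ 2 := by positivity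
  haveI : Nontrivial (Fin d) := Fin.nontrivial_iff_two_le.mpr hd2
  obtain ⟨-, hg', hj', hl'⟩ := B8Prop3KLevelBdry.apriori_160_bdry (L := (L : ℝ)) (B₀ := B₀) (α₁ := α₁') (C₂ := Cγ)
    (Nat.cast_nonneg d) hB₀.le hα₂.le hg0 h55
    (by
      refine B8Eq155JBound.wsup_le (fun p => ?_) (by positivity)
      obtain ⟨⟨j, b⟩, hj, hc | ⟨hj0, hcr⟩⟩ := p
      · have hj' : j ≤ c.k := hj
        have hc' : b ∈ c.lamBPT c.k j := hc
        show 1 * ‖linCovIter L (1 : Site d → Fin d → 𝔸ˣ) (iEta η A) j b.1 b.2‖ ≤ _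
        rw [one_mul]
        have h := norm_B1_lt_kLevel_γ hη L hL (avgClosed_unitaryUnits d L) (1 : Site d → Fin d → 𝔸ˣ) hone hα₀' hα3γ hα4γ A hα₂.le hsmγ hc₃γ
          hbox h33 h41'' h42 hj' hc'
        have e : 8 * (131072 * ((d : ℝ) + 1) ^ 2)
            * Real.exp (4 * (800 * ((d : ℝ) + 1) ^ 2 * ((d : ℝ) + 4)) * ((L : ℝ) ^ 2 * α₀')) * (L : ℝ) ^ 2 * α₂ ^ 2 = Cγ * α₂ ^ 2 := by
          rw [hCγ_def]
        linarith [h, e]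
      · have hj0' : j = 0 := hj0
        subst hj0'
        have hbt' : BondTouches (c.sq 0) b.1 b.2 := hcr.1
        have hnb' : ¬ (b.1 ∈ c.sq 0 ∧ b.1 + e b.2 ∈ c.sq 0) := hcr.2
        show 1 * ‖linCovIter L (1 : Site d → Fin d → 𝔸ˣ) (iEta η A) 0 b.1 b.2‖ ≤ _
        rw [one_mul, B7Prop4GeneralLevels.linCovIter_zero, B8Eq154Local.norm_iEta_apply hη.le]
        obtain ⟨κ, hκ⟩ := exists_ne b.2
        have hsd : SideTouches (c.sq 0) b.1 b.2 := B8Eq140Level.sideTouches_of_bondTouches hκ hbt'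
        have h1 : 2 * α₁' ≤ 2 * d * L * α₁' := by
          have h := mul_le_mul_of_nonneg_right hdL (by positivity : (0 : ℝ) ≤ 2 * α₁')
          linarith [h]
        linarith [hcol b hsd hnb', h1, hC0])
    h59a h59g h59j h59l hside h50
  have hK : 2 * Cγ * α₂ ^ 2 ≤ 2 * C₂ * α₂ ^ 2 := by
    have hL20 : (0 : ℝ) ≤ (L : ℝ) ^ 2 := by positivity
    have hCγ' : Cγ ≤ 2097152 * ((d : ℝ) + 1) ^ 2 * (L : ℝ) ^ 2 := by
      rw [hCγ_def]
      exact mul_le_mul_of_nonneg_right hCγ hL20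
    have h := mul_le_mul_of_nonneg_right (hCγ'.trans hC₂) (sq_nonneg α₂)
    linarith
  have hR : B₀ * (4 * α₀' + 4 * d * L * α₁' + 2 * α₂ ^ 2 + 20 * d * α₀' * α₂ + 2 * Cγ * α₂ ^ 2)
      ≤ B₀ * (4 * α₀' + 4 * d * L * α₁' + 2 * α₂ ^ 2 + 20 * d * α₀' * α₂ + 2 * C₂ * α₂ ^ 2) :=
    mul_le_mul_of_nonneg_left (by linarith [hK]) hB₀.le
  have h162 := B8Prop3KLevelBdry.apriori_162_bdry (C₂ := C₂) (α₂ := α₂) hB₀.le hdL hα₀'.le h61 hβ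
  have e5 : 5 * (d : ℝ) * L * B₀ * (α₀' + α₁') = α₂ := by simp only [hα₀'_def, hα₁'_def, hα₂_def]
  refine ⟨?_, ?_, ?_⟩
  · linarith [hg', hR, h162, e5]
  · linarith [hj', hR, h162, e5]
  · linarith [hl', hR, h162, e5]

#print axioms norms136_dentedMember_at_γ_d4

end Literature.MathematicalPhysics.QuantumFieldTheory.Balaban1983to89.B8Prop6DentedCubeMemberNormsGamma

end
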